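import Summits.RiemannHypothesis.RiemannHypothesis.Theorems.LiDirichletEchoImGammaShift
import Summits.RiemannHypothesis.RiemannHypothesis.Theorems.LiDirichletEchoCharWindowAdjust
import HarnessLib

/-!
# RiemannHypothesis / LiDirichletEcho — complex companion, part 5: moving the window ends in the imaginary channel
# (RH-FREE, GRH-FREE)

RH-FREE · GRH-FREE [rh-li-eng g5].  Towards `LiTheory.LiZeroWindowEchoDirichletComplex` (imaginary channel).  For primitive
`χ` mod `q > 1` and `c ≥ 1` there are `N`, `C = C(q)` such that for `n ≥ N`, `√n ≤ T₁ ≤ √n + 1`, `c√n ≤ T₂ ≤ c√n + 1`: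

  `|Im charUpperTraceWindowC χ n √n (c√n) − Im charUpperTraceWindowC χ n T₁ T₂| ≤ C log n` and
  `|charSmoothOddWindow χ n √n (c√n) − charSmoothOddWindow χ n T₁ T₂| ≤ C log n`.

Proof = `Theorems/LiDirichletEchoCharWindowAdjust.lean` verbatim with `Im` for `Re` and `sin` for `cos`: a unit step of the
complex upper trace is the Li sum over the zeros of the step, each weight `≤ e^{1/2}` in norm whatever the real part
(`WindowAdjust.norm_pow_one_sub_inv_le`), the unit-window multiplicity count `ExplicitPsiChar.exists_sum_window_le`; the odd smooth
end pieces by `|g_χ(t)| ≤ ½ log(t + 4) + 4 + ½|log(q/π)|` (`WindowAdjustChar.abs_charGammaDensity_le`).  Nothing here bears on the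
truth of RH or GRH.
-/

noncomputable section

-- D-0017: `Summit.<S>.<S>.…` is the designed namespace of a single-problem summit.
set_option linter.dupNamespace false

open Complex MeasureTheory intervalIntegral Set
open scoped Real ComplexConjugate Interval

namespace Summit.RiemannHypothesis.RiemannHypothesis.Theorems.LiTheory

open Literature.NumberTheory.LFunctions Literature.NumberTheory.LFunctions.ExplicitPsiChar

namespace ImWindowAdjustChar

open WindowAdjustChar

variable {q : ℕ} [NeZero q] {χ : DirichletCharacter ℂ q}

/-- A step of the COMPLEX upper trace is the Li sum over the zeros of the step: for `0 ≤ a ≤ a'` (`χ ≠ 1`),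
`U_C(a') − U_C(a) = Σᶠ_{a < Im ρ ≤ a'} m(ρ)(1 − 1/ρ)ⁿ`. -/
theorem charUpperZeroTraceC_sub_eq (h1 : χ ≠ 1) (n : ℕ) {a a' : ℝ} (ha : 0 ≤ a) (haa' : a ≤ a') :
    charUpperZeroTraceC χ n a' - charUpperZeroTraceC χ n a =
      ∑ᶠ ρ ∈ {ρ : ℂ | ρ ∈ charNontrivialZeros χ ∧ a < ρ.im ∧ ρ.im ≤ a'},
        (DirichletDisc.zeroOrder χ ρ : ℂ) * (1 - 1 / ρ) ^ n := by
  -- as `WindowAdjustChar.charUpperZeroTrace_sub_eq`, without taking real parts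
  set S₁ : Set ℂ := lfunctionZeroBox χ a ∩ {ρ : ℂ | 0 < ρ.im} with hS₁
  set W : Set ℂ := {ρ : ℂ | ρ ∈ charNontrivialZeros χ ∧ a < ρ.im ∧ ρ.im ≤ a'} with hW
  have hS₁f : S₁.Finite := (lfunctionZeroBox_finite h1 a).subset inter_subset_left
  have hWf : W.Finite := by
    refine (lfunctionZeroBox_finite h1 a').subset ?_
    rintro ρ ⟨hρ, h3, h4⟩
    obtain ⟨hL, h0, h1'⟩ := mem_charNontrivialZeros.1 hρ
    exact mem_lfunctionZeroBox.2 ⟨hL, h0, h1', abs_le.2 ⟨by linarith, h4⟩⟩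
  have hunion : lfunctionZeroBox χ a' ∩ {ρ : ℂ | 0 < ρ.im} = S₁ ∪ W := by
    ext ρ
    simp only [hS₁, hW, mem_inter_iff, mem_union, mem_setOf_eq, mem_lfunctionZeroBox, mem_charNontrivialZeros]
    constructor
    · rintro ⟨⟨hL, h0, h1', habs⟩, him⟩
      by_cases hle : ρ.im ≤ a
      · exact Or.inl ⟨⟨hL, h0, h1', abs_le.2 ⟨by linarith, hle⟩⟩, him⟩
      · exact Or.inr ⟨⟨hL, h0, h1'⟩, lt_of_not_ge hle, (abs_le.1 habs).2⟩
    · rintro (⟨⟨hL, h0, h1', habs⟩, him⟩ | ⟨⟨hL, h0, h1'⟩, h3, h4⟩)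
      · exact ⟨⟨hL, h0, h1', (abs_le.2 ⟨by linarith [(abs_le.1 habs).1], by linarith [(abs_le.1 habs).2]⟩)⟩, him⟩
      · exact ⟨⟨hL, h0, h1', abs_le.2 ⟨by linarith, h4⟩⟩, by
          show 0 < ρ.im
          linarith⟩
  have hdisj : Disjoint S₁ W := by
    rw [Set.disjoint_left]
    rintro ρ ⟨hρ, -⟩ ⟨-, h3, -⟩
    have := (abs_le.1 (mem_lfunctionZeroBox.1 hρ).2.2.2).2
    linarith
  unfold charUpperZeroTraceC
  rw [hunion, finsum_mem_union hdisj hS₁f hWf]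
  ring

/-- **Complex upper-trace step bound (imaginary part):** with the absolute constant `C` of `exists_sum_window_le`, for
primitive `χ` mod `q > 1`, `1 ≤ n ≤ a²`, `0 ≤ a ≤ a' ≤ a + 1`:
`|Im U_C(a') − Im U_C(a)| ≤ e^{1/2} C (log q + log(|a + 1/2| + 4))`. -/
theorem abs_im_charUpperZeroTraceC_step_le :
    ∃ C : ℝ, 0 < C ∧ ∀ (q : ℕ) [NeZero q] (χ : DirichletCharacter ℂ q), χ.IsPrimitive → 1 < q →
      ∀ (n : ℕ) (a a' : ℝ), 1 ≤ n → (n : ℝ) ≤ a ^ 2 → 0 ≤ a → a ≤ a' → a' ≤ a + 1 →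
        |(charUpperZeroTraceC χ n a').im - (charUpperZeroTraceC χ n a).im| ≤
          Real.exp (1 / 2) * (C * (Real.log q + Real.log (|a + 1 / 2| + 4))) := by
  classical
  obtain ⟨C, hC0, hC⟩ := exists_sum_window_le
  refine ⟨C, hC0, fun q _ χ hχ hq n a a' hn hna ha haa' ha1 ↦ ?_⟩
  have h1 : χ ≠ 1 := ne_one_of_isPrimitive hχ hq
  rw [← Complex.sub_im, charUpperZeroTraceC_sub_eq h1 n ha haa']
  set W : Set ℂ := {ρ : ℂ | ρ ∈ charNontrivialZeros χ ∧ a < ρ.im ∧ ρ.im ≤ a'} with hW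
  have hWf : W.Finite := by
    refine (lfunctionZeroBox_finite h1 a').subset ?_
    rintro ρ ⟨hρ, h3, h4⟩
    obtain ⟨hL, h0, h1'⟩ := mem_charNontrivialZeros.1 hρ
    exact mem_lfunctionZeroBox.2 ⟨hL, h0, h1', abs_le.2 ⟨by linarith, h4⟩⟩
  set P := hWf.toFinset with hP
  have hmem : ∀ ρ, ρ ∈ P ↔ ρ ∈ W := fun ρ ↦ Set.Finite.mem_toFinset _
  rw [finsum_mem_eq_finite_toFinset_sum _ hWf, Complex.im_sum]
  have hPcond : ∀ ρ ∈ P, χ.LFunction ρ = 0 ∧ 0 < ρ.re ∧ ρ.re < 1 ∧ |ρ.im - (a + 1 / 2)| ≤ 1 / 2 := by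
    intro ρ hρ
    obtain ⟨hρ', h3, h4⟩ := (hmem ρ).1 hρ
    obtain ⟨hL, h0, h1'⟩ := mem_charNontrivialZeros.1 hρ'
    exact ⟨hL, h0, h1', abs_le.2 ⟨by linarith, by linarith⟩⟩
  have hcount := hC q χ hχ hq (a + 1 / 2) P hPcond
  have hterm : ∀ ρ ∈ P, |((DirichletDisc.zeroOrder χ ρ : ℂ) * (1 - 1 / ρ) ^ n).im| ≤
      (DirichletDisc.zeroOrder χ ρ : ℝ) * Real.exp (1 / 2) := by
    intro ρ hρ
    obtain ⟨hρ', h3, -⟩ := (hmem ρ).1 hρ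
    obtain ⟨-, h0, -⟩ := mem_charNontrivialZeros.1 hρ'
    have hγ : (n : ℝ) ≤ ρ.im ^ 2 := hna.trans (by nlinarith)
    have hm : (0 : ℝ) ≤ DirichletDisc.zeroOrder χ ρ := Nat.cast_nonneg _
    have him : ((DirichletDisc.zeroOrder χ ρ : ℂ) * (1 - 1 / ρ) ^ n).im =
        (DirichletDisc.zeroOrder χ ρ : ℝ) * ((1 - 1 / ρ) ^ n).im := by
      simp [Complex.mul_im]
    rw [him, abs_mul, abs_of_nonneg hm]
    exact mul_le_mul_of_nonneg_left
      ((Complex.abs_im_le_norm _).trans (WindowAdjust.norm_pow_one_sub_inv_le n h0.le hn hγ)) hm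
  calc |∑ ρ ∈ P, ((DirichletDisc.zeroOrder χ ρ : ℂ) * (1 - 1 / ρ) ^ n).im|
      ≤ ∑ ρ ∈ P, |((DirichletDisc.zeroOrder χ ρ : ℂ) * (1 - 1 / ρ) ^ n).im| := Finset.abs_sum_le_sum_abs _ _
    _ ≤ ∑ ρ ∈ P, (DirichletDisc.zeroOrder χ ρ : ℝ) * Real.exp (1 / 2) := Finset.sum_le_sum hterm
    _ = Real.exp (1 / 2) * ∑ ρ ∈ P, (DirichletDisc.zeroOrder χ ρ : ℝ) := by rw [Finset.mul_sum]; simp [mul_comm]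
    _ ≤ Real.exp (1 / 2) * (C * (Real.log q + Real.log (|a + 1 / 2| + 4))) :=
        mul_le_mul_of_nonneg_left hcount (Real.exp_pos _).le

omit [NeZero q] in
/-- The odd smooth integrand is continuous on every `[a, b]` with `a > 0`. -/
theorem continuousOn_smoothOdd_integrand (χ : DirichletCharacter ℂ q) (n : ℕ) {a b : ℝ} (ha : 0 < a) (hab : a ≤ b) :
    ContinuousOn (fun t ↦ Real.sin (n * liZeroAngle t) * charGammaDensity χ t) (uIcc a b) := by
  rw [uIcc_of_le hab]
  have hθ : ContinuousOn liZeroAngle (Icc a b) := fun t ht ↦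
    (hasDerivAt_liZeroAngle (by linarith [ht.1] : t ≠ 0)).continuousAt.continuousWithinAt
  have hsin : ContinuousOn (fun t ↦ Real.sin (n * liZeroAngle t)) (Icc a b) :=
    Real.continuous_sin.comp_continuousOn (continuousOn_const.mul hθ)
  exact hsin.mul fun t _ ↦ (continuousAt_charGammaDensity χ t).continuousWithinAt

omit [NeZero q] in
/-- A unit end piece of the odd smooth mean: for `1 ≤ a ≤ a' ≤ a + 1`,
`|∫_a^{a'} sin(nθ) g_χ| ≤ ½ log(a + 5) + 4 + ½|log(q/π)|`. -/
theorem abs_integral_odd_end_le (χ : DirichletCharacter ℂ q) (n : ℕ) {a a' : ℝ} (ha : 1 ≤ a) (haa' : a ≤ a')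
    (ha' : a' ≤ a + 1) :
    |∫ t in a..a', Real.sin (n * liZeroAngle t) * charGammaDensity χ t| ≤
      Real.log (a + 5) / 2 + 4 + |Real.log (q / Real.pi)| / 2 := by
  set K : ℝ := Real.log (a + 5) / 2 + 4 + |Real.log (q / Real.pi)| / 2 with hK
  have hK0 : 0 ≤ K := by
    have := Real.log_nonneg (by linarith : (1 : ℝ) ≤ a + 5); rw [hK]; positivity
  have hpt : ∀ t ∈ Ι a a', ‖Real.sin (n * liZeroAngle t) * charGammaDensity χ t‖ ≤ K := by
    intro t ht
    rw [uIoc_of_le haa'] at ht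
    have ht1 : 1 ≤ t := by linarith [ht.1]
    rw [Real.norm_eq_abs, abs_mul]
    have hc := Real.abs_sin_le_one (n * liZeroAngle t)
    have hg := abs_charGammaDensity_le χ ht1
    have hlog : Real.log (t + 4) ≤ Real.log (a + 5) := Real.log_le_log (by linarith) (by linarith [ht.2])
    calc |Real.sin (n * liZeroAngle t)| * |charGammaDensity χ t|
        ≤ 1 * (Real.log (t + 4) / 2 + 4 + |Real.log (q / Real.pi)| / 2) :=
          mul_le_mul hc hg (abs_nonneg _) zero_le_one
      _ ≤ K := by rw [hK]; linarith
  have h := intervalIntegral.norm_integral_le_of_norm_le_const hpt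
  rw [Real.norm_eq_abs, abs_of_nonneg (by linarith : (0 : ℝ) ≤ a' - a)] at h
  have hlen : a' - a ≤ 1 := by linarith
  calc |∫ t in a..a', Real.sin (n * liZeroAngle t) * charGammaDensity χ t| ≤ K * (a' - a) := h
    _ ≤ K * 1 := mul_le_mul_of_nonneg_left hlen hK0
    _ = K := mul_one _

end ImWindowAdjustChar

open ImWindowAdjustChar in
/-- **Window-end adjustment in the imaginary channel** (RH-FREE, GRH-FREE): for primitive `χ` mod `q > 1` and `c ≥ 1` there
are `N`, `C` such that for `n ≥ N`, `√n ≤ T₁ ≤ √n + 1`, `c√n ≤ T₂ ≤ c√n + 1`, moving the window `(√n, c√n]` to `(T₁, T₂]`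
changes `Im` of the complex upper trace and the odd smooth mean by at most `C log n` each. -/
theorem charImWindowAdjust_bound {q : ℕ} [NeZero q] (χ : DirichletCharacter ℂ q) (hχ : χ.IsPrimitive) (hq : 1 < q) :
    ∀ c : ℝ, 1 ≤ c → ∃ N : ℕ, ∃ C : ℝ, ∀ n : ℕ, N ≤ n → ∀ T₁ T₂ : ℝ, Real.sqrt n ≤ T₁ → T₁ ≤ Real.sqrt n + 1 →
      c * Real.sqrt n ≤ T₂ → T₂ ≤ c * Real.sqrt n + 1 →
      |(charUpperTraceWindowC χ n (Real.sqrt n) (c * Real.sqrt n)).im - (charUpperTraceWindowC χ n T₁ T₂).im|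
          ≤ C * Real.log n ∧
      |charSmoothOddWindow χ n (Real.sqrt n) (c * Real.sqrt n) - charSmoothOddWindow χ n T₁ T₂| ≤ C * Real.log n := by
  -- as `charWindowAdjust_bound` (Theorems/LiDirichletEchoCharWindowAdjust.lean)
  intro c hc
  obtain ⟨A, hA0, hA⟩ := abs_im_charUpperZeroTraceC_step_le
  set Lq : ℝ := 1 + Real.log q with hLq
  set Kq : ℝ := |Real.log (q / Real.pi)| / 2 with hKq
  have hq1 : (1 : ℝ) ≤ q := by exact_mod_cast NeZero.one_le
  have hlogq : 0 ≤ Real.log q := Real.log_nonneg hq1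
  have hKq0 : 0 ≤ Kq := by positivity
  refine ⟨⌈(c + 5) ^ 2⌉₊, 2 * Real.exp (1 / 2) * A * Lq + 9 + 2 * Kq, fun n hn T₁ T₂ hT₁l hT₁u hT₂l hT₂u ↦ ?_⟩
  have hc2 : (c + 5) ^ 2 ≤ (n : ℝ) := (Nat.le_ceil _).trans (by exact_mod_cast hn)
  set s := Real.sqrt n with hs
  have hn0 : (0 : ℝ) ≤ n := by positivity
  have hss : s ^ 2 = n := by rw [hs, Real.sq_sqrt hn0]
  have hs3 : c + 5 ≤ s := by
    rw [hs, ← Real.sqrt_sq (by linarith : 0 ≤ c + 5)]; exact Real.sqrt_le_sqrt hc2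
  have hs1 : 1 ≤ s := by linarith
  have hs0 : 0 < s := by linarith
  have hn36 : (36 : ℝ) ≤ n := by nlinarith
  have hn1 : 1 ≤ n := by exact_mod_cast (show (1 : ℝ) ≤ n by linarith)
  have hcs : s ≤ c * s := le_mul_of_one_le_left hs0.le hc
  have htop : c * s + 5 ≤ n := by
    have : (c + 5) * s ≤ s * s := mul_le_mul_of_nonneg_right hs3 hs0.le
    nlinarith
  have hlogn1 : 1 ≤ Real.log n := by
    rw [Real.le_log_iff_exp_le (by linarith)]
    have := Real.exp_one_lt_d9; linarith
  have hlogn0 : 0 ≤ Real.log n := by linarith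
  have hlog_cs : Real.log (c * s + 5) ≤ Real.log n := Real.log_le_log (by positivity) htop
  have hlog_s : Real.log (s + 5) ≤ Real.log n := Real.log_le_log (by positivity) (by nlinarith)
  have hL1 : Real.log q + Real.log (|s + 1 / 2| + 4) ≤ Lq * Real.log n := by
    rw [abs_of_pos (by positivity)]
    have : Real.log (s + 1 / 2 + 4) ≤ Real.log n := (Real.log_le_log (by positivity) (by linarith)).trans hlog_s
    have hprod := mul_nonneg hlogq (sub_nonneg.2 hlogn1)
    rw [hLq]; linarith [hprod]
  have hL2 : Real.log q + Real.log (|c * s + 1 / 2| + 4) ≤ Lq * Real.log n := by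
    rw [abs_of_pos (by positivity)]
    have : Real.log (c * s + 1 / 2 + 4) ≤ Real.log n := (Real.log_le_log (by positivity) (by linarith)).trans hlog_cs
    have hprod := mul_nonneg hlogq (sub_nonneg.2 hlogn1)
    rw [hLq]; linarith [hprod]
  have he := Real.exp_pos (1 / 2 : ℝ)
  constructor
  · have hZ : (charUpperTraceWindowC χ n s (c * s)).im - (charUpperTraceWindowC χ n T₁ T₂).im =
        ((charUpperZeroTraceC χ n T₁).im - (charUpperZeroTraceC χ n s).im)
          - ((charUpperZeroTraceC χ n T₂).im - (charUpperZeroTraceC χ n (c * s)).im) := by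
      unfold charUpperTraceWindowC; simp only [Complex.sub_im]; ring
    rw [hZ]
    have hns : (n : ℝ) ≤ s ^ 2 := hss.ge
    have hncs : (n : ℝ) ≤ (c * s) ^ 2 := by nlinarith
    have h1 := hA q χ hχ hq n s T₁ hn1 hns hs0.le hT₁l hT₁u
    have h2 := hA q χ hχ hq n (c * s) T₂ hn1 hncs (by positivity) hT₂l hT₂u
    calc |(charUpperZeroTraceC χ n T₁).im - (charUpperZeroTraceC χ n s).im
          - ((charUpperZeroTraceC χ n T₂).im - (charUpperZeroTraceC χ n (c * s)).im)|
        ≤ |(charUpperZeroTraceC χ n T₁).im - (charUpperZeroTraceC χ n s).im|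
          + |(charUpperZeroTraceC χ n T₂).im - (charUpperZeroTraceC χ n (c * s)).im| := abs_sub _ _
      _ ≤ Real.exp (1 / 2) * (A * (Lq * Real.log n)) + Real.exp (1 / 2) * (A * (Lq * Real.log n)) :=
          add_le_add (h1.trans (by gcongr)) (h2.trans (by gcongr))
      _ = (2 * Real.exp (1 / 2) * A * Lq) * Real.log n := by ring
      _ ≤ (2 * Real.exp (1 / 2) * A * Lq + 9 + 2 * Kq) * Real.log n := by
          have h0 : 0 ≤ (9 + 2 * Kq) * Real.log n := by positivity
          linarith [h0]
  · set g : ℝ → ℝ := fun t ↦ Real.sin (n * liZeroAngle t) * charGammaDensity χ t with hg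
    have hint : ∀ a b : ℝ, 0 < a → a ≤ b → IntervalIntegrable g volume a b := fun a b ha hab ↦
      (continuousOn_smoothOdd_integrand χ n ha hab).intervalIntegrable
    have i1 : IntervalIntegrable g volume s T₁ := hint s T₁ hs0 hT₁l
    have i2 : IntervalIntegrable g volume T₁ (c * s) := by
      rcases le_total T₁ (c * s) with h | h
      · exact hint T₁ (c * s) (by linarith) h
      · exact (hint (c * s) T₁ (by positivity) h).symm
    have i3 : IntervalIntegrable g volume (c * s) T₂ := hint (c * s) T₂ (by positivity) hT₂l
    have hsplit : (∫ t in s..(c * s), g t) - ∫ t in T₁..T₂, g t = (∫ t in s..T₁, g t) - ∫ t in (c * s)..T₂, g t := by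
      rw [← intervalIntegral.integral_add_adjacent_intervals i1 i2,
        ← intervalIntegral.integral_add_adjacent_intervals i2 i3]
      ring
    have hS : charSmoothOddWindow χ n s (c * s) - charSmoothOddWindow χ n T₁ T₂ =
        2 / Real.pi * ((∫ t in s..T₁, g t) - ∫ t in (c * s)..T₂, g t) := by
      unfold charSmoothOddWindow; rw [← hsplit, mul_sub]
    rw [hS, abs_mul, abs_of_pos (by positivity : (0 : ℝ) < 2 / Real.pi)]
    have e1 := abs_integral_odd_end_le χ n hs1 hT₁l hT₁u
    have e2 := abs_integral_odd_end_le χ n (le_trans hs1 hcs) hT₂l hT₂u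
    rw [← hKq] at e1 e2
    have hπ : 2 / Real.pi ≤ 1 := by rw [div_le_one Real.pi_pos]; linarith [Real.pi_gt_three]
    have hsum : |(∫ t in s..T₁, g t) - ∫ t in (c * s)..T₂, g t| ≤ (9 + 2 * Kq) * Real.log n := by
      refine (abs_sub _ _).trans ?_
      have := add_le_add e1 e2
      have hK := mul_nonneg hKq0 (sub_nonneg.2 hlogn1)
      linarith [hK, this, hlog_s, hlog_cs, hlogn1]
    have hA7 : (9 + 2 * Kq) * Real.log n ≤ (2 * Real.exp (1 / 2) * A * Lq + 9 + 2 * Kq) * Real.log n := by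
      have hLq0 : 0 ≤ Lq := by rw [hLq]; positivity
      have : 0 ≤ 2 * Real.exp (1 / 2) * A * Lq * Real.log n := by positivity
      linarith [this]
    calc 2 / Real.pi * |(∫ t in s..T₁, g t) - ∫ t in (c * s)..T₂, g t| ≤ 1 * ((9 + 2 * Kq) * Real.log n) :=
          mul_le_mul hπ hsum (abs_nonneg _) zero_le_one
      _ ≤ (2 * Real.exp (1 / 2) * A * Lq + 9 + 2 * Kq) * Real.log n := by linarith

end Summit.RiemannHypothesis.RiemannHypothesis.Theorems.LiTheory

end
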